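import Summits.Ventures.HodgeRepro2.T5QuadraticCensusToy
import Summits.Ventures.HodgeRepro2.T5QuadraticSplitRamified
import Summits.Ventures.HodgeRepro2.T5SplitPrimeToy

/-!
# T5QuadraticSplitToy — the split side of the census on one instance: `5` in `ℚ(i) = ℚ(√−1)`

Tier-5 kernel support (seat p8, blind lane; sub-step N3; README §10.5 (ii)(c)/(d) non-vacuity and
joint consistency of T5-176's split criterion).  On `L = ℚ(ζ₄)`, `x = ζ₄`, `d = −1`, `v = (5)`:
`−1 ≡ 2²` is a square modulo `5` (`isSquare_neg_one_mod_five`, through `𝓞_ℚ ⧸ (5) ≃+* ZMod 5`),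
`4 · (−1) ∉ (5)`, so the split criterion returns two distinct places of `ℚ(i)` over `5`
(`exists_ne_liesOver_five`) and `5` does NOT stay prime (`not_staysPrime_five`) — agreeing with
T5-164's direct factorisation `5 = (2 − i)(2 + i)` (`wFiveA ≠ wFiveB`, both over `vFive`).

No `sorry`, no axiom beyond `propext`, `Classical.choice`, `Quot.sound`.
-/

namespace Summit.Ventures.HodgeRepro2.T5QuadraticSplitToy

open NumberField IsDedekindDomain HeightOneSpectrum

variable (L : Type*) [Field L] [CharZero L] [IsCyclotomicExtension {2 ^ 2} ℚ L]

/-- The ideal of the place `vFive` is `(5)`. -/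
theorem vFive_asIdeal : T5SplitPrimeToy.vFive.asIdeal = Ideal.span {5} := rfl

/-- `4 · (−1) ∉ (5)` in `𝓞_ℚ`. -/
theorem four_mul_neg_one_not_mem_five : 4 * (-1 : 𝓞 ℚ) ∉ T5SplitPrimeToy.vFive.asIdeal := by
  rw [vFive_asIdeal, Ideal.mem_span_singleton]
  intro h
  have h' := map_dvd Rat.ringOfIntegersEquiv h
  rw [map_mul, map_neg, map_one, map_ofNat, map_ofNat] at h'
  norm_num at h'

/-- `−1` is a square modulo `5` in `𝓞_ℚ ⧸ (5)` (`−1 ≡ 2²`, read in `ZMod 5` along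
`𝓞_ℚ ⧸ (5) ≃+* ℤ ⧸ (5) ≃+* ZMod 5`). -/
theorem isSquare_neg_one_mod_five :
    IsSquare (Ideal.Quotient.mk T5SplitPrimeToy.vFive.asIdeal (-1 : 𝓞 ℚ)) := by
  have e : (𝓞 ℚ ⧸ T5SplitPrimeToy.vFive.asIdeal) ≃+* ZMod 5 :=
    (Ideal.quotientEquiv T5SplitPrimeToy.vFive.asIdeal (Ideal.span {((5 : ℕ) : ℤ)})
      Rat.ringOfIntegersEquiv (by
        rw [vFive_asIdeal, Ideal.map_span, Set.image_singleton, map_ofNat]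
        simp)).trans (Int.quotientSpanNatEquivZMod 5)
  have h : IsSquare (-1 : ZMod 5) := ⟨2, by decide⟩
  have h' := h.map e.symm
  have he : e.symm (-1 : ZMod 5) = Ideal.Quotient.mk T5SplitPrimeToy.vFive.asIdeal (-1 : 𝓞 ℚ) := by
    simp
  rwa [he] at h'

/-- **`5` splits in `ℚ(i)` by the Legendre symbol**: two distinct finite places of `ℚ(ζ₄)` over
`(5)`, from T5-176's split criterion (`(−1 / 5) = +1`). -/
theorem exists_ne_liesOver_five :
    ∃ w₁ w₂ : HeightOneSpectrum (𝓞 L), w₁ ≠ w₂ ∧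
      w₁.asIdeal.LiesOver T5SplitPrimeToy.vFive.asIdeal ∧
      w₂.asIdeal.LiesOver T5SplitPrimeToy.vFive.asIdeal := by
  haveI : NumberField L := IsCyclotomicExtension.numberField {2 ^ 2} ℚ L
  exact T5QuadraticSplitRamified.exists_ne_liesOver_of_isSquare T5SplitPrimeToy.vFive
    (T5InertPrimeToy.finrank_eq_two L) (T5QuadraticCensusToy.toInteger_mul_self L)
    (T5QuadraticCensusToy.toInteger_not_mem_range L) four_mul_neg_one_not_mem_five
    isSquare_neg_one_mod_five

/-- `5` does not stay prime in `ℚ(i)` (the census, read at a square). -/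
theorem not_staysPrime_five :
    ¬ ∃ w : HeightOneSpectrum (𝓞 L),
      T5SplitPrimeToy.vFive.asIdeal.map (algebraMap (𝓞 ℚ) (𝓞 L)) = w.asIdeal := by
  haveI : NumberField L := IsCyclotomicExtension.numberField {2 ^ 2} ℚ L
  rw [T5QuadraticConductor.exists_map_eq_asIdeal_iff_not_isSquare T5SplitPrimeToy.vFive
    (T5InertPrimeToy.finrank_eq_two L) (T5QuadraticCensusToy.toInteger_mul_self L)
    (T5QuadraticCensusToy.toInteger_not_mem_range L) four_mul_neg_one_not_mem_five]
  exact not_not.mpr isSquare_neg_one_mod_five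

/-- Joint consistency (README §10.5 (ii)(d)): T5-164's two places `wFiveA ≠ wFiveB` over `(5)` are
an instance of the split criterion's conclusion. -/
theorem split_agree :
    (∃ w₁ w₂ : HeightOneSpectrum (𝓞 L), w₁ ≠ w₂ ∧
        w₁.asIdeal.LiesOver T5SplitPrimeToy.vFive.asIdeal ∧
        w₂.asIdeal.LiesOver T5SplitPrimeToy.vFive.asIdeal) ∧
      (T5SplitPrimeToy.wFiveA L ≠ T5SplitPrimeToy.wFiveB L ∧
        (T5SplitPrimeToy.wFiveA L).asIdeal.LiesOver T5SplitPrimeToy.vFive.asIdeal ∧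
        (T5SplitPrimeToy.wFiveB L).asIdeal.LiesOver T5SplitPrimeToy.vFive.asIdeal) :=
  ⟨exists_ne_liesOver_five L, T5SplitPrimeToy.wFiveA_ne_wFiveB L, T5SplitPrimeToy.liesOverA L,
    T5SplitPrimeToy.liesOverB L⟩

end Summit.Ventures.HodgeRepro2.T5QuadraticSplitToy
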